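import Summits.AtomisticToContinuum.HydrodynamicLimit.Theorems.ImplosionDichotomyImplosionUnboundedDensity
import Summits.AtomisticToContinuum.HydrodynamicLimit.Theorems.ImplosionDichotomyImplosionUnboundedDensityTracking

/-!
# `ImplosionDichotomy.ImplosionUnboundedDensity` from the implosion fact, the Kato/Majda inputs and
# the fixed-horizon a-priori estimate

Route support item stmt-AtomisticToContinuum-12590 (`ImplosionUnboundedDensity`, route
`ImplosionDichotomy` of `AtomisticToContinuum/HydrodynamicLimit`). This file composes the two landed
helper files of the item:

* `…Theorems.ImplosionDichotomyImplosionUnboundedDensity` — the glue, in particular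
  `implosionUnboundedDensity_of_pdeTracking` (statics discharged: the item from an ideal density field
  unbounded on `[0, T₁)` and the pure PDE tracking statement (TRACK) with the prescribed data
  `(rhoLim (profileOf a₀) σ, u₀, θ₀)`), and the ideal-gas input
  `exists_smooth_isentropic_idealGasImplosion_of_thm12` from the vendored named fact
  `Literature.Analysis.FluidPDE.CaolaboraEtAl2025_thm12_euler (5/3)`;
* `…Theorems.ImplosionDichotomyImplosionUnboundedDensityTracking` —
  `hsEuler_tracking_of_local_continuation_apriori`: (TRACK) from (a) local classical existence for
  the statics data (Kato 1975 Thm II / Majda 1984 Thm 2.1), (b) continuation below a packing cap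
  under uniform state and `C¹` bounds (Majda 1984 Thm 2.2) and (c) the fixed-horizon a-priori
  tracking estimate (the one piece of new analysis),

into `implosionUnboundedDensity_of_thm12_of_local_continuation_apriori`: the item conditional on the
published implosion theorem, the two published Kato/Majda inputs (a), (b) stated for SMOOTH positive
profiles, and the estimate (c) for ideal solutions with data `(a₀/∫a₀, u₀, θ₀)`, `T₁ > 0`. When (a)
and (b) are vendored as named facts for the hard-sphere system (as planned on the neighbouring line
`log-lipschitz-budget` of the crux `PolynomialCompression`), the item rests on (c) alone.
-/

namespace Summit.AtomisticToContinuum.HydrodynamicLimit.Theorems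

open Set MeasureTheory
open Literature.MathematicalPhysics.KineticTheory Literature.Analysis.FunctionSpaces

/-- **`ImplosionUnboundedDensity` from the implosion fact, the two Kato/Majda inputs and the
fixed-horizon a-priori estimate.** Assume `CaolaboraEtAl2025_thm12_euler (5/3)` and, for the
hard-sphere Euler system at reduced diameter `σ > 0`: (a) local classical existence for the statics
data `(rhoLim (profileOf a₀) σ, u₀, θ₀)` of SMOOTH positive profiles at every small `σ`
(Kato 1975 Thm II / Majda 1984 Thm 2.1); (b) continuation of classical solutions obeying uniform
state and `C¹` bounds below a packing cap (Majda 1984 Thm 2.2); (c) for smooth positive profiles and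
every classical ideal (`σ = 0`) solution `(ρ₁, u₁, θ₁)` on `[0, T₁)`, `T₁ > 0`, with data
`(a₀/∫a₀, u₀, θ₀)`: the a-priori tracking estimate on every horizon `T' < T₁` (state/`C¹` bounds,
packing `≤ η`, density `ε`-close to `ρ₁`, for all classical `σ`-solutions with the statics data on
`[0, T)`, `T ≤ T'`, once `σ` is small). Then `ImplosionUnboundedDensity`: the smooth implosion
profiles of `exists_smooth_isentropic_idealGasImplosion_of_thm12`, the tracking
`hsEuler_tracking_of_local_continuation_apriori`, and the statics-discharged glue
`implosionUnboundedDensity_of_pdeTracking`. [cite: CaolaboraEtAl2025, Thm 1.2 + Rem 1.4 + Rem 1.5] -/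
theorem implosionUnboundedDensity_of_thm12_of_local_continuation_apriori
    (hfact : Literature.Analysis.FluidPDE.CaolaboraEtAl2025_thm12_euler (5 / 3))
    (hloc : ∀ (a₀ θ₀ : T3 → ℝ) (u₀ : T3 → V3) (ha : Torus.IsSmooth a₀), Torus.IsSmooth θ₀ →
      Torus.IsSmooth u₀ → ∀ (ha0 : ∀ x, 0 < a₀ x), (∀ x, 0 < θ₀ x) →
      ∃ σa : ℝ, 0 < σa ∧ ∀ σ : ℝ, 0 < σ → σ < σa →
        ∃ T : ℝ, 0 < T ∧ ∃ (ρ θ : ℝ → T3 → ℝ) (u : ℝ → T3 → V3),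
          IsHardSphereEulerSolution σ T ρ u θ ∧
          ρ 0 = rhoLim (profileOf a₀ ha.continuous ha0) σ ∧ u 0 = u₀ ∧ θ 0 = θ₀)
    (hcont : ∃ ηb : ℝ, 0 < ηb ∧ ∀ σ : ℝ, 0 < σ → ∀ M : ℝ, 0 < M → ∀ T : ℝ, 0 < T →
      ∀ (ρ θ : ℝ → T3 → ℝ) (u : ℝ → T3 → V3), IsHardSphereEulerSolution σ T ρ u θ →
        (∀ t ∈ Ico 0 T, ∀ x,
          M⁻¹ ≤ ρ t x ∧ ρ t x ≤ M ∧ M⁻¹ ≤ θ t x ∧ θ t x ≤ M ∧ ‖u t x‖ ≤ M ∧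
          ρ t x * σ ^ 3 ≤ ηb ∧
          ∀ i : Fin 3, ‖Torus.partialDeriv i (u t) x‖ ≤ M ∧
            |Torus.partialDeriv i (ρ t) x| ≤ M ∧ |Torus.partialDeriv i (θ t) x| ≤ M) →
        ∃ T₂ : ℝ, T < T₂ ∧ ∃ (ρ' θ' : ℝ → T3 → ℝ) (u' : ℝ → T3 → V3),
          IsHardSphereEulerSolution σ T₂ ρ' u' θ' ∧
          ∀ t ∈ Ico 0 T, ρ' t = ρ t ∧ u' t = u t ∧ θ' t = θ t)
    (hapriori : ∀ (a₀ θ₀ : T3 → ℝ) (u₀ : T3 → V3) (ha : Torus.IsSmooth a₀), Torus.IsSmooth θ₀ →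
      Torus.IsSmooth u₀ → ∀ (ha0 : ∀ x, 0 < a₀ x), (∀ x, 0 < θ₀ x) →
      ∀ (T₁ : ℝ) (ρ₁ θ₁ : ℝ → T3 → ℝ) (u₁ : ℝ → T3 → V3), 0 < T₁ →
        IsHardSphereEulerSolution 0 T₁ ρ₁ u₁ θ₁ → (∀ x, ρ₁ 0 x = a₀ x / ∫ y, a₀ y) →
        u₁ 0 = u₀ → θ₁ 0 = θ₀ →
        ∀ T' : ℝ, 0 < T' → T' < T₁ → ∀ η : ℝ, 0 < η → ∀ ε : ℝ, 0 < ε →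
          ∃ σ₀ : ℝ, 0 < σ₀ ∧ ∃ M : ℝ, 0 < M ∧ ∀ σ : ℝ, 0 < σ → σ < σ₀ →
            ∀ T : ℝ, T ≤ T' → ∀ (ρ θ : ℝ → T3 → ℝ) (u : ℝ → T3 → V3),
              IsHardSphereEulerSolution σ T ρ u θ →
              ρ 0 = rhoLim (profileOf a₀ ha.continuous ha0) σ → u 0 = u₀ → θ 0 = θ₀ →
              ∀ t ∈ Ico 0 T, ∀ x,
                (M⁻¹ ≤ ρ t x ∧ ρ t x ≤ M ∧ M⁻¹ ≤ θ t x ∧ θ t x ≤ M ∧ ‖u t x‖ ≤ M ∧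
                  ρ t x * σ ^ 3 ≤ η ∧
                  ∀ i : Fin 3, ‖Torus.partialDeriv i (u t) x‖ ≤ M ∧
                    |Torus.partialDeriv i (ρ t) x| ≤ M ∧ |Torus.partialDeriv i (θ t) x| ≤ M) ∧
                |ρ t x - ρ₁ t x| < ε) :
    Summit.AtomisticToContinuum.HydrodynamicLimit.Theses.ImplosionDichotomy.ImplosionUnboundedDensity := by
  obtain ⟨a₀, θ₀, u₀, ha, hθ, hu, ha0, hθ0, T₁, -, ρ₁, θ₁, u₁, hT₁, -, hsol, hρd, hud, hθd, -,
    hunb⟩ := exists_smooth_isentropic_idealGasImplosion_of_thm12 hfact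
  exact implosionUnboundedDensity_of_pdeTracking ha.continuous hθ.continuous hu.continuous ha0 hθ0
    hunb
    (hsEuler_tracking_of_local_continuation_apriori ha.continuous ha0 (hloc a₀ θ₀ u₀ ha hθ hu ha0 hθ0)
      hcont (hapriori a₀ θ₀ u₀ ha hθ hu ha0 hθ0 T₁ ρ₁ θ₁ u₁ hT₁ hsol hρd hud hθd))

end Summit.AtomisticToContinuum.HydrodynamicLimit.Theorems
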